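import Summits.ResolutionOfSingularities.ResolutionOfSingularities.Theorems.WeightedInvariantAQSBaseChangeLexMax
import Summits.ResolutionOfSingularities.ResolutionOfSingularities.Theorems.WeightedInvariantAQSBaseChangeSquare
import Summits.ResolutionOfSingularities.ResolutionOfSingularities.Theorems.WeightedInvariantAQSBaseChangeResidueField
import Literature.AlgebraicGeometry.Resolution.StalkIdealLemmas
import HarnessLib

/-!
# Abramovich–Quek–Schober's separable base change in the kernel, for field extensions essentially of finite type

Route `ResolutionOfSingularities/WeightedInvariant`, door crux `HypersurfaceCentreConstruction`
(stmt-ResolutionOfSingularities-19897) — OURS, helper; e-ladder `e = 1`, piece **(o25-δ)** «separable base change of the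
Abramovich–Quek–Schober centre in the kernel» (res-D-pv-025 AS stub-10; CHAIN w43 v4.18 (3)), brick **(δ3) — the ASSEMBLY**.

`separableBaseChange_of_essFiniteType` is the statement of the vendored fact
`AbramovichQuekSchober2025_separableBaseChange` (Literature `…/HypersurfaceHeightTwoWeightedCentre.lean`: the lex-maximal
admissible weighted centre germ is stable under the base change `Y′ = Y ×_k k′ → Y` along a formally smooth `k′/k`, at
points `η′` over `η` where `dim 𝒪_{Y′,η′} = 2`), PROVED under the ONE EXTRA hypothesis `[Algebra.EssFiniteType k k′]`
(finite separable extensions, rational function fields `k(t₁,…,t_m)` = the torus charts the e-ladder actually uses in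
(L3)), from

* (δ2) res-type-047's `separableBaseChange_localData` (p526461): `φ = g.stalkMap η′` is flat with `𝔪·𝒪′ = 𝔪′`,
  `𝒪′` regular, residue extension formally smooth — the essential-finite-type hypothesis enters ONLY here (the fibre
  ring is regular by «smooth ⇒ regular»; the general formally smooth case needs Matsumura Thm 28.7
  «`𝔪`-smooth local ⇒ regular», not in the tree);
* (δ-field) `mem_range_algebraMap_of_pow_mem` (p522038): the residue extension is then relatively `p`-radically closed;
* (δ1c) `isLexMaxWeightedCentreGerm_map` (file `…AQSBaseChangeLexMax`): the local theorem.

So the typed fact is discharged on the essentially-of-finite-type locus of its `k′`; its literal `_holds` (all formally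
smooth `k′`) is blocked on exactly Matsumura 28.7.  Def-free; nothing here is a claim about Hironaka's problem.
AI-written; weaker than expert review.  [cite: AbramovichQuekSchober2025, Thm 1.3 (1) / Thm 3.5; Matsumura1987, Thm 28.7]
-/

noncomputable section

set_option linter.dupNamespace false -- mandated namespace of this single-conjunct summit

namespace Summit.ResolutionOfSingularities.ResolutionOfSingularities.Theorems.AQSBaseChange

open CategoryTheory AlgebraicGeometry IsLocalRing Literature.AlgebraicGeometry.Resolution

/-- **Abramovich–Quek–Schober, Thm 1.3 (1) «`J` is stable under base change to separable field extensions of `k`»,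
for `k′/k` formally smooth AND essentially of finite type.**  The statement of
`AbramovichQuekSchober2025_separableBaseChange` with the extra instance `[Algebra.EssFiniteType k k']`.
[cite: AbramovichQuekSchober2025, Thm 1.3 (1), Thm 3.5 (proof p. 7 L94 – p. 8 L40)] -/
theorem separableBaseChange_of_essFiniteType (k : Type) [Field k] (Y : Scheme.{0}) (f : Y ⟶ Spec (.of k))
    [LocallyOfFiniteType f] (X : Y.IdealSheafData)
    (k' : Type) [Field k'] [Algebra k k'] [Algebra.FormallySmooth k k'] [Algebra.EssFiniteType k k']
    (Y' : Scheme.{0}) (f' : Y' ⟶ Spec (.of k')) (g : Y' ⟶ Y)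
    (hsq : IsPullback g f' f (Spec.map (CommRingCat.ofHom (algebraMap k k'))))
    (η' : Y') (hdim' : ringKrullDim (Y'.presheaf.stalk η') = ((2 : ℕ) : WithBot ℕ∞))
    (hreg : IsRegularLocalRing (Y.presheaf.stalk (g.base η')))
    (hdim : ringKrullDim (Y.presheaf.stalk (g.base η')) = ((2 : ℕ) : WithBot ℕ∞))
    (hprinc : (stalkIdeal X (g.base η')).IsPrincipal)
    (x : Fin 2 → Y.presheaf.stalk (g.base η')) (w : Fin 2 → ℕ) (ℓ : ℕ)
    (hx : IsLexMaxWeightedCentreGerm (Y.presheaf.stalk (g.base η')) (stalkIdeal X (g.base η')) x w ℓ) :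
    IsLexMaxWeightedCentreGerm (Y'.presheaf.stalk η') (stalkIdeal (X.comap g) η')
      (fun i => (g.stalkMap η').hom (x i)) w ℓ := by
  obtain ⟨h𝔪, hreg', hflat, hfs⟩ := separableBaseChange_localData f k' hsq η' hreg hdim hdim'
  letI := (g.stalkMap η').hom.toAlgebra
  haveI : IsLocalHom (algebraMap (Y.presheaf.stalk (g.base η')) (Y'.presheaf.stalk η')) :=
    inferInstanceAs (IsLocalHom (g.stalkMap η').hom)
  haveI : Module.Flat (Y.presheaf.stalk (g.base η')) (Y'.presheaf.stalk η') := hflat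
  haveI : Module.FaithfullyFlat (Y.presheaf.stalk (g.base η')) (Y'.presheaf.stalk η') :=
    Module.FaithfullyFlat.of_flat_of_isLocalHom
  haveI := hreg
  haveI := hreg'
  -- the residue field extension is relatively `p`-radically closed
  letI algκ := (IsLocalRing.ResidueField.map (g.stalkMap η').hom).toAlgebra
  haveI : Algebra.FormallySmooth (ResidueField (Y.presheaf.stalk (g.base η'))) (ResidueField (Y'.presheaf.stalk η')) := hfs
  obtain ⟨p, hp⟩ := ExpChar.exists (ResidueField (Y.presheaf.stalk (g.base η')))
  haveI : ExpChar (ResidueField (Y'.presheaf.stalk η')) p :=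
    expChar_of_injective_algebraMap
      (algebraMap (ResidueField (Y.presheaf.stalk (g.base η'))) (ResidueField (Y'.presheaf.stalk η'))).injective p
  have hcl : ∀ z : ResidueField (Y'.presheaf.stalk η'),
      z ^ p ∈ (ResidueField.map (algebraMap (Y.presheaf.stalk (g.base η')) (Y'.presheaf.stalk η'))).range →
        z ∈ (ResidueField.map (algebraMap (Y.presheaf.stalk (g.base η')) (Y'.presheaf.stalk η'))).range :=
    fun z hz => mem_range_algebraMap_of_pow_mem p hz
  -- the principal ideal and the local theorem
  haveI := hprinc
  have hgen := Ideal.span_singleton_generator (stalkIdeal X (g.base η'))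
  rw [← hgen] at hx
  have key := isLexMaxWeightedCentreGerm_map hdim hdim' h𝔪 p hcl hx
  rw [stalkIdeal_comap_eq_map_stalkMap, ← hgen, Ideal.map_span, Set.image_singleton]
  exact key

end Summit.ResolutionOfSingularities.ResolutionOfSingularities.Theorems.AQSBaseChange

end
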